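import Summits.Ventures.YMGap.RobustBall.BoundaryStateEntropy
import HarnessLib

/-!
# Venture YMGap, track ROBUST-BALL — «C-ENT-μ» AT TWO COUPLINGS: the relative entropy of THE state at coupling `b` with respect to the
# finite-volume Gibbs laws at coupling `b'` is volume × `[(b' − b)(2 − u(b)) + (f(b') − f(b))/6]` ± surface, `SU(2)` on `ℤ⁴`

HONEST FRAMING. WHAT THIS IS: a venture file (cell `pub-ymgap`, track Y2 ROBUST-BALL / DS, seat ds-3, theorems only, 0 compute): the two-coupling
extension of the information-gain-zero theorem of `BoundaryStateEntropy`. `SU(2)`, `d = 4`, tree couplings `b, b' ∈ [0, 9/50]` (Wilson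
`β_W, β_W' ∈ [0, 9/25]`); `μ` THE DLR state at `b` (unique, axis symmetric), `u(b)` its mean plaquette, `f = freeEnergyDensity 4 ρ₂`, `μ|_Λ` the
marginal on the links of a finite region `Λ`, `π_Λ^{b',η₀} = Haar_Λ.tilted(−b' S_Λ(· ⊕ η₀))` the inner Gibbs law AT THE OTHER COUPLING with ANY
boundary field `η₀`, `∂T(Λ) = {p ∈ T(Λ) : p ⊄ Λ}`, surface sums `Σ_c = Σ_{p∈T(Λ)} min 4 (1024√2·e^{−κ₁(R_G(2c))⌊m_p/4⌋})` at `c = b, b'`: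
* ★★★ `su2_abs_klDiv_state_restrict_inner_law_two_couplings_sub_le` —
  `|KL(μ|_Λ ‖ π_Λ^{b',η₀}) − #T(Λ)·[(b' − b)(2 − u(b)) + (f(b') − f(b))/6]| ≤ 2b·Σ_b + b'·Σ_{b'} + 4(b + b')·#∂T(Λ)` — the identity
  `KL(ν ‖ π^{b',η₀}) = KL(ν ‖ Haar) + b'·ν(S(· ⊕ η₀)) + log Z_{b'}(η₀)` (`BoundaryVariationalPrinciple`) with `ν = μ|_Λ`, the entropy asymptotics of
  `BoundaryStateEntropy`, the glued-restricted energy and «C-DS-I» at `b'`;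
* ★★★ `su2_klDiv_state_restrict_inner_law_two_couplings_div_vanHove_tendsto` — along every van Hove sequence with depth data and EVERY sequence
  of boundary fields: `KL(μ|_{Λ_n} ‖ π_{Λ_n}^{b',η_n})/#T(Λ_n) → (b' − b)(2 − u(b)) + (f(b') − f(b))/6` — THE SPECIFIC RELATIVE ENTROPY OF THE STATE
  AT `b` WITH RESPECT TO THE GIBBS LAWS AT `b'`; at `b' = b` it is `0` (information gain zero), in general it is the Bregman-type divergence of the
  free energy per plaquette;
(Remark, not formalised here: positivity of the limit says `f(b') ≥ f(b) − 6(b' − b)(2 − u(b))` — the supporting line of slope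
`−6(2 − u(b))`, i.e. `f' = −6 × mean plaquette energy`, consistent with ds-1's «C-PRESS»; it needs one explicit van Hove sequence, e.g. the cubes
of `BoundaryFreeEnergyBoxes`.)
WHAT THIS IS NOT: lattice strong coupling on the star window; relative entropies on finite regions; nothing about the continuum limit or Clay.
Everything here is proved. [folklore]
-/

noncomputable section

open MeasureTheory ProbabilityTheory InformationTheory Filter Topology Real Finset Set
open scoped NNReal ENNReal
open Literature.Probability.LatticeModels hiding configShift configShift_apply
open Literature.MathematicalPhysics.QuantumLattice
open Literature.MathematicalPhysics.QuantumFieldTheory (haarProbability)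
open Summit.Ventures.YMGap.StarWindowGauge (gaugeR gaugeR_lt_one_of_le)
open Summit.Ventures.YMGap.StarLemmaG (gaugeR_nonneg)

namespace Summit.Ventures.YMGap.RobustBall

namespace BoundaryFreeEnergy

section SU2

/-- ★★★ **THE RELATIVE ENTROPY OF THE STATE AT `b` WITH RESPECT TO THE INNER GIBBS LAW AT `b'` = VOLUME × BREGMAN DIVERGENCE ± SURFACE**
(`SU(2)`, `d = 4`, tree couplings `b, b' ∈ [0, 9/50]`; `μ` THE DLR state at `b`; finite `Λ`, depth data `(φ, m)`, ANY boundary field `η₀`):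
`|KL(μ|_Λ ‖ π_Λ^{b',η₀}) − #T(Λ)·[(b' − b)(2 − u(b)) + (f(b') − f(b))/6]| ≤ 2b·Σ_b + b'·Σ_{b'} + 4(b + b')·#∂T(Λ)`, and this divergence is finite.
[folklore] -/
theorem su2_abs_klDiv_state_restrict_inner_law_two_couplings_sub_le {b b' : ℝ} (hb0 : 0 ≤ b) (hb : b ≤ 9 / 50)
    (hb0' : 0 ≤ b') (hb' : b' ≤ 9 / 50)
    {μ : Measure (LGConfig 4 (SUN 2))} (hμ : μ ∈ ymGibbsMeasures (d := 4) (fundamentalRep (Fin 2)) b)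
    (Λ : Finset (ZdEdge 4)) (η₀ : LGConfig 4 (SUN 2)) (φ : ZdEdge 4 → ℝ) (hφ : ∀ x y : ZdEdge 4, φ x ≤ φ y + ‖x.1 - y.1‖)
    (hφΛ : ∀ x, 0 < φ x → x ∈ Λ) (m : ZdPlaquette 4 → ℝ) (hm : ∀ p ∈ plaquettesTouching Λ, ∀ x ∈ plaquetteEdges p, m p ≤ φ x) :
    klDiv (μ.map (fun U (e : ↥Λ) => U e)) ((Measure.pi fun _ : ↥Λ => haarProbability (SUN 2)).tilted
        (fun ζ => -b' * wilsonBoundaryAction (fundamentalRep (Fin 2)) Λ (glueWith Λ ζ η₀))) ≠ ∞ ∧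
    |(klDiv (μ.map (fun U (e : ↥Λ) => U e)) ((Measure.pi fun _ : ↥Λ => haarProbability (SUN 2)).tilted
        (fun ζ => -b' * wilsonBoundaryAction (fundamentalRep (Fin 2)) Λ (glueWith Λ ζ η₀)))).toReal -
        (plaquettesTouching Λ).card * ((b' - b) * ((2 : ℝ) - ∫ U, plaquetteObs (fundamentalRep (Fin 2)) 0 0 1 U ∂μ) +
          (freeEnergyDensity 4 (fundamentalRep (Fin 2)) b' - freeEnergyDensity 4 (fundamentalRep (Fin 2)) b) / 6)| ≤
      2 * b * ∑ p ∈ plaquettesTouching Λ, min 4 (1024 * Real.sqrt 2 * Real.exp (-(starRate 4 (gaugeR (2 * b)) * ⌊m p / (4 : ℕ)⌋₊))) +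
        b' * ∑ p ∈ plaquettesTouching Λ, min 4 (1024 * Real.sqrt 2 * Real.exp (-(starRate 4 (gaugeR (2 * b')) * ⌊m p / (4 : ℕ)⌋₊))) +
        4 * (b + b') * ((plaquettesTouching Λ).filter fun p => ¬plaquetteEdges p ⊆ Λ).card := by
  classical
  have hρc : Continuous (fundamentalRep (Fin 2)) := continuous_fundamentalRep (Fin 2)
  have hGibbs : IsGibbsMeasure (ymSpecification (d := 4) (fundamentalRep (Fin 2)) b) μ := hμ
  haveI := hGibbs.isProbabilityMeasure
  have hr : Measurable fun (U : LGConfig 4 (SUN 2)) (e : ↥Λ) => U e := measurable_pi_lambda _ fun e => measurable_pi_apply _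
  haveI : IsProbabilityMeasure (μ.map (fun U (e : ↥Λ) => U e)) := Measure.isProbabilityMeasure_map hr.aemeasurable
  set H : Measure (↥Λ → SUN 2) := Measure.pi fun _ : ↥Λ => haarProbability (SUN 2) with hH
  haveI : IsProbabilityMeasure H := by rw [hH]; infer_instance
  set T := plaquettesTouching Λ with hTdef
  set Sb : ℝ := ∑ p ∈ T, min 4 (1024 * Real.sqrt 2 * Real.exp (-(starRate 4 (gaugeR (2 * b)) * ⌊m p / (4 : ℕ)⌋₊))) with hSb
  set Sb' : ℝ := ∑ p ∈ T, min 4 (1024 * Real.sqrt 2 * Real.exp (-(starRate 4 (gaugeR (2 * b')) * ⌊m p / (4 : ℕ)⌋₊))) with hSb'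
  set D : ℝ := ((T.filter fun p => ¬plaquetteEdges p ⊆ Λ).card : ℝ) with hD
  set u := ∫ U, plaquetteObs (fundamentalRep (Fin 2)) 0 0 1 U ∂μ with hu
  set f := freeEnergyDensity 4 (fundamentalRep (Fin 2)) b with hf
  set f' := freeEnergyDensity 4 (fundamentalRep (Fin 2)) b' with hf'
  obtain ⟨hac, hint⟩ := map_restrict_ac_integrable_llr (fundamentalRep (Fin 2)) hρc b Λ hμ
  -- the identity at coupling b': KL(μ_Λ ‖ π^{b',η₀}) = KL(μ_Λ ‖ H) + b' ∫ S(· ⊕ η₀) dμ_Λ + log Z_{b'}(η₀)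
  have hid := toReal_klDiv_inner_law_eq (fundamentalRep (Fin 2)) hρc b' Λ η₀ (μ.map (fun U (e : ↥Λ) => U e)) hac hint
  have hexpH : Integrable (fun ζ => Real.exp (-b' * wilsonBoundaryAction (fundamentalRep (Fin 2)) Λ (glueWith Λ ζ η₀))) H :=
    integrable_exp_neg_mul_action_glueWith (fundamentalRep (Fin 2)) hρc b' Λ η₀ H
  have hSc : Continuous (wilsonBoundaryAction (G := SUN 2) (fundamentalRep (Fin 2)) Λ) := continuous_wilsonBoundaryAction _ hρc Λ
  obtain ⟨C, hC⟩ := exists_bound_of_continuous hSc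
  have hfm : Measurable fun ζ : ↥Λ → SUN 2 => -b' * wilsonBoundaryAction (fundamentalRep (Fin 2)) Λ (glueWith Λ ζ η₀) :=
    (hSc.measurable.comp (measurable_glueWith Λ η₀)).const_mul _
  have hne : klDiv (μ.map (fun U (e : ↥Λ) => U e)) (H.tilted fun ζ => -b' * wilsonBoundaryAction (fundamentalRep (Fin 2)) Λ (glueWith Λ ζ η₀)) ≠ ∞ := by
    refine klDiv_ne_top (hac.trans (absolutelyContinuous_tilted hexpH)) ?_
    refine integrable_llr_tilted_right hac (integrable_of_bound hfm.aestronglyMeasurable (C := |b'| * C) fun ζ => ?_) hint hexpH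
    rw [abs_mul, abs_neg]; exact mul_le_mul_of_nonneg_left (hC _) (abs_nonneg b')
  refine ⟨hne, ?_⟩
  -- axis symmetry of THE state at b
  obtain ⟨ν, h1, h2, -, -⟩ := su2_wilson_oneState_symmetric (b := b) (abs_le.2 ⟨by linarith, hb⟩)
  have hμν : μ = ν := by rw [h1] at hμ; exact Set.mem_singleton_iff.1 hμ
  have hνL : ν ∈ infiniteVolumeLimitPoints (d := 4) (fundamentalRep (Fin 2)) b := by rw [h2]; exact Set.mem_singleton _
  have hplane : ∀ p ∈ T, ∫ U, plaquetteObs (fundamentalRep (Fin 2)) p.1 p.2.1.1 p.2.1.2 U ∂μ = u := fun p _ => by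
    rw [hu, hμν]; exact PlaquettePositivity.integral_plaquetteObs_eq (fundamentalRep (Fin 2)) hρc (by norm_num) hνL p.1 (ne_of_lt p.2.2)
  have hsum : ∑ p ∈ T, ((2 : ℝ) - ∫ U, plaquetteObs (fundamentalRep (Fin 2)) p.1 p.2.1.1 p.2.1.2 U ∂μ) = (T.card : ℝ) * (2 - u) := by
    rw [Finset.sum_congr rfl fun p hp => by rw [hplane p hp], Finset.sum_const, nsmul_eq_mul]
  -- (1) two-sided entropy asymptotics of the marginal at b
  have hKL := su2_abs_klDiv_state_restrict_sub_le hb0 hb hμ Λ φ hφ hφΛ m hm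
  rw [← hTdef] at hKL
  rw [← hSb, ← hu, ← hf, abs_le] at hKL
  -- (2) two-sided glued-restricted energy at η₀
  have hE2 : |∫ ζ, wilsonBoundaryAction (fundamentalRep (Fin 2)) Λ (glueWith Λ ζ η₀) ∂(μ.map (fun U (e : ↥Λ) => U e)) -
      T.card * (2 - u)| ≤ 2 * (2 : ℕ) * D := by
    have hmap : ∫ ζ, wilsonBoundaryAction (fundamentalRep (Fin 2)) Λ (glueWith Λ ζ η₀) ∂(μ.map (fun U (e : ↥Λ) => U e)) =
        ∫ U, wilsonBoundaryAction (fundamentalRep (Fin 2)) Λ (glueWith Λ (fun e : ↥Λ => U e) η₀) ∂μ :=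
      integral_map hr.aemeasurable ((hSc.measurable.comp (measurable_glueWith Λ η₀)).aestronglyMeasurable)
    rw [hmap]
    have hi1 : Integrable (fun U : LGConfig 4 (SUN 2) => wilsonBoundaryAction (fundamentalRep (Fin 2)) Λ (glueWith Λ (fun e : ↥Λ => U e) η₀)) μ :=
      integrable_of_bound ((hSc.measurable.comp ((measurable_glueWith Λ η₀).comp hr)).aestronglyMeasurable) (C := C) fun U => hC _
    have hi0 : Integrable (fun U : LGConfig 4 (SUN 2) => wilsonBoundaryAction (fundamentalRep (Fin 2)) Λ U) μ :=
      integrable_of_bound hSc.measurable.aestronglyMeasurable (C := C) fun U => hC U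
    have hdiff : |∫ U, (wilsonBoundaryAction (fundamentalRep (Fin 2)) Λ (glueWith Λ (fun e : ↥Λ => U e) η₀) -
        wilsonBoundaryAction (fundamentalRep (Fin 2)) Λ U) ∂μ| ≤ 2 * (2 : ℕ) * D := by
      have h := norm_integral_le_of_norm_le_const (μ := μ) (C := 2 * (2 : ℕ) * D)
        (f := fun U : LGConfig 4 (SUN 2) => wilsonBoundaryAction (fundamentalRep (Fin 2)) Λ (glueWith Λ (fun e : ↥Λ => U e) η₀) -
          wilsonBoundaryAction (fundamentalRep (Fin 2)) Λ U) (ae_of_all _ fun U => by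
          rw [Real.norm_eq_abs]; exact suN_abs_action_glue_restrict_sub_le (N := 2) Λ U η₀)
      rw [Real.norm_eq_abs] at h
      simpa using h
    rw [integral_sub hi1 hi0, suN_integral_wilsonBoundaryAction_eq_sum] at hdiff
    rw [← hTdef] at hdiff
    push_cast at hdiff ⊢
    rw [hsum] at hdiff
    exact hdiff
  -- (3) «C-DS-I» at b' for log Z_{b'}(η₀)
  have hZ := su2_abs_log_normaliser_sub_freeEnergy_le hb0' hb' Λ η₀ φ hφ hφΛ m hm
  rw [← hTdef] at hZ
  rw [← hSb', ← hf', abs_le] at hZ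
  rw [abs_le] at hE2
  set X := ∫ ζ, wilsonBoundaryAction (fundamentalRep (Fin 2)) Λ (glueWith Λ ζ η₀) ∂(μ.map (fun U (e : ↥Λ) => U e)) with hX
  set LZ := Real.log (∫ ζ, Real.exp (-b' * wilsonBoundaryAction (fundamentalRep (Fin 2)) Λ (glueWith Λ ζ η₀))
    ∂(Measure.pi fun _ : ↥Λ => haarProbability (SUN 2))) with hLZ
  set kl := (klDiv (μ.map (fun U (e : ↥Λ) => U e)) H).toReal with hkl
  have hidR : (klDiv (μ.map (fun U (e : ↥Λ) => U e))
      (H.tilted fun ζ => -b' * wilsonBoundaryAction (fundamentalRep (Fin 2)) Λ (glueWith Λ ζ η₀))).toReal = kl + b' * X + LZ := hid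
  have hbX1 : b' * X ≤ b' * (T.card * (2 - u) + 2 * (2 : ℕ) * D) := mul_le_mul_of_nonneg_left (by linarith [hE2.2]) hb0'
  have hbX2 : b' * (T.card * (2 - u) - 2 * (2 : ℕ) * D) ≤ b' * X := mul_le_mul_of_nonneg_left (by linarith [hE2.1]) hb0'
  rw [← hD] at hKL
  rw [hidR, abs_le]
  push_cast at hbX1 hbX2 ⊢
  have e1 : (T.card : ℝ) / 6 * f' = (T.card : ℝ) * (f' / 6) := by ring
  constructor
  · linarith [hKL.1, hbX2, hZ.1, e1]
  · linarith [hKL.2, hbX1, hZ.2, e1]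

/-- **Budget lemma, general profile**: if `g(K) → 0` and the shallow fractions `s_n(K) → 0` for every `K`, then for every `ε > 0` there are `K`, `n₀`
with `g K + A·s_n(K) ≤ ε` for all `n ≥ n₀`. [folklore] -/
theorem exists_budget_of_tendsto (g : ℕ → ℝ) (hg : Tendsto g atTop (𝓝 0)) (A : ℝ) (s : ℕ → ℕ → ℝ)
    (hs : ∀ K : ℕ, Tendsto (fun n => s n K) atTop (𝓝 0)) {ε : ℝ} (hε : 0 < ε) :
    ∃ K n₀ : ℕ, ∀ n ≥ n₀, g K + A * s n K ≤ ε := by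
  obtain ⟨K, hK⟩ := (hg.eventually (eventually_le_nhds (show (0 : ℝ) < ε / 2 by linarith))).exists
  have h2 : Tendsto (fun n => A * s n K) atTop (𝓝 0) := by simpa using (hs K).const_mul A
  obtain ⟨n₀, hn₀⟩ := eventually_atTop.1 (h2.eventually (eventually_le_nhds (show (0 : ℝ) < ε / 2 by linarith)))
  exact ⟨K, n₀, fun n hn => by linarith [hK, hn₀ n hn]⟩

/-- ★★★ **THE SPECIFIC RELATIVE ENTROPY OF THE STATE AT `b` WITH RESPECT TO THE GIBBS LAWS AT `b'`** (`SU(2)`, `d = 4`, `b, b' ∈ [0, 9/50]`; `μ` THE DLR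
state at `b`; van Hove sequence with depth data as in `BoundaryVanHoveLimit`; ANY sequence of boundary fields `η_n`):
`KL(μ|_{Λ_n} ‖ π_{Λ_n}^{b',η_n})/#T(Λ_n) → (b' − b)(2 − u(b)) + (f(b') − f(b))/6` — zero at `b' = b` (information gain zero), the Bregman-type
divergence of the free energy per plaquette in general. [folklore] -/
theorem su2_klDiv_state_restrict_inner_law_two_couplings_div_vanHove_tendsto {b b' : ℝ} (hb0 : 0 ≤ b) (hb : b ≤ 9 / 50)
    (hb0' : 0 ≤ b') (hb' : b' ≤ 9 / 50)
    {μ : Measure (LGConfig 4 (SUN 2))} (hμ : μ ∈ ymGibbsMeasures (d := 4) (fundamentalRep (Fin 2)) b)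
    (Λ : ℕ → Finset (ZdEdge 4)) (hT : ∀ n, (plaquettesTouching (Λ n)).Nonempty)
    (φ : ℕ → ZdEdge 4 → ℝ) (hφ : ∀ n (x y : ZdEdge 4), φ n x ≤ φ n y + ‖x.1 - y.1‖) (hφΛ : ∀ n x, 0 < φ n x → x ∈ Λ n)
    (m : ℕ → ZdPlaquette 4 → ℝ) (hm : ∀ n, ∀ p ∈ plaquettesTouching (Λ n), ∀ x ∈ plaquetteEdges p, m n p ≤ φ n x)
    (hvH : ∀ K : ℕ, Tendsto (fun n => ((((plaquettesTouching (Λ n)).filter fun p => m n p < 4 * K).card : ℝ)) /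
      (plaquettesTouching (Λ n)).card) atTop (𝓝 0)) (η : ℕ → LGConfig 4 (SUN 2)) :
    Tendsto (fun n => (klDiv (μ.map (fun U (e : ↥(Λ n)) => U e)) ((Measure.pi fun _ : ↥(Λ n) => haarProbability (SUN 2)).tilted
        (fun ζ => -b' * wilsonBoundaryAction (fundamentalRep (Fin 2)) (Λ n) (glueWith (Λ n) ζ (η n))))).toReal / (plaquettesTouching (Λ n)).card)
      atTop (𝓝 ((b' - b) * ((2 : ℝ) - ∫ U, plaquetteObs (fundamentalRep (Fin 2)) 0 0 1 U ∂μ) +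
        (freeEnergyDensity 4 (fundamentalRep (Fin 2)) b' - freeEnergyDensity 4 (fundamentalRep (Fin 2)) b) / 6)) := by
  classical
  rw [Metric.tendsto_atTop]
  intro ε hε
  set κ : ℝ := starRate 4 (gaugeR (2 * b)) with hκ
  set κ' : ℝ := starRate 4 (gaugeR (2 * b')) with hκ'
  set C : ℝ := 1024 * Real.sqrt 2 with hC
  have hC0 : 0 ≤ C := by positivity
  have hκ0 : 0 < κ := starRate_pos (gaugeR_nonneg (by linarith) (by linarith)) (gaugeR_lt_one_of_le (by linarith) (by linarith))
  have hκ0' : 0 < κ' := starRate_pos (gaugeR_nonneg (by linarith) (by linarith)) (gaugeR_lt_one_of_le (by linarith) (by linarith))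
  -- the exponential profile at budget `K + 1`
  set g : ℕ → ℝ := fun K => 2 * b * (C * Real.exp (-(κ * ((K + 1 : ℕ) : ℝ)))) + b' * (C * Real.exp (-(κ' * ((K + 1 : ℕ) : ℝ)))) with hg
  have hg0 : Tendsto g atTop (𝓝 0) := by
    have e1 : Tendsto (fun K : ℕ => Real.exp (-(κ * ((K + 1 : ℕ) : ℝ)))) atTop (𝓝 0) :=
      Real.tendsto_exp_neg_atTop_nhds_zero.comp (Tendsto.const_mul_atTop hκ0
        (tendsto_natCast_atTop_atTop.comp (tendsto_add_atTop_nat 1)))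
    have e2 : Tendsto (fun K : ℕ => Real.exp (-(κ' * ((K + 1 : ℕ) : ℝ)))) atTop (𝓝 0) :=
      Real.tendsto_exp_neg_atTop_nhds_zero.comp (Tendsto.const_mul_atTop hκ0'
        (tendsto_natCast_atTop_atTop.comp (tendsto_add_atTop_nat 1)))
    have := ((e1.const_mul C).const_mul (2 * b)).add ((e2.const_mul C).const_mul b')
    simpa [hg] using this
  obtain ⟨K, n₀, hKn⟩ := exists_budget_of_tendsto g hg0 (12 * b + 8 * b')
    (fun n K => ((((plaquettesTouching (Λ n)).filter fun p => m n p < 4 * ((K + 1 : ℕ) : ℝ)).card : ℝ)) / (plaquettesTouching (Λ n)).card)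
    (fun K => by simpa using hvH (K + 1)) (show (0 : ℝ) < ε / 2 by linarith)
  refine ⟨n₀, fun n hn => ?_⟩
  rw [Real.dist_eq]
  have hTpos : (0 : ℝ) < ((plaquettesTouching (Λ n)).card : ℝ) := by exact_mod_cast Finset.card_pos.2 (hT n)
  have hmain := (su2_abs_klDiv_state_restrict_inner_law_two_couplings_sub_le hb0 hb hb0' hb' hμ (Λ n) (η n) (φ n) (hφ n) (hφΛ n)
    (m n) (hm n)).2
  have hS := surface_sum_le_of_depth hκ0.le hC0 (plaquettesTouching (Λ n)) (m n) (K + 1)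
  have hS' := surface_sum_le_of_depth hκ0'.le hC0 (plaquettesTouching (Λ n)) (m n) (K + 1)
  have hD : ((((plaquettesTouching (Λ n)).filter fun p => ¬plaquetteEdges p ⊆ Λ n).card : ℕ) : ℝ) ≤
      ((((plaquettesTouching (Λ n)).filter fun p => m n p < 4 * ((K + 1 : ℕ) : ℝ)).card : ℕ) : ℝ) := by
    exact_mod_cast card_boundaryPlaquettes_le_card_shallow (Λ n) (φ n) (hφΛ n) (m n) (hm n) (K := K + 1) (by omega)
  have hK' := hKn n hn
  set Tn : ℝ := ((plaquettesTouching (Λ n)).card : ℝ) with hTn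
  set sh : ℝ := ((((plaquettesTouching (Λ n)).filter fun p => m n p < 4 * ((K + 1 : ℕ) : ℝ)).card : ℕ) : ℝ) with hsh
  set kl := (klDiv (μ.map (fun U (e : ↥(Λ n)) => U e)) ((Measure.pi fun _ : ↥(Λ n) => haarProbability (SUN 2)).tilted
    (fun ζ => -b' * wilsonBoundaryAction (fundamentalRep (Fin 2)) (Λ n) (glueWith (Λ n) ζ (η n))))).toReal with hkl
  set L := (b' - b) * ((2 : ℝ) - ∫ U, plaquetteObs (fundamentalRep (Fin 2)) 0 0 1 U ∂μ) +
    (freeEnergyDensity 4 (fundamentalRep (Fin 2)) b' - freeEnergyDensity 4 (fundamentalRep (Fin 2)) b) / 6 with hL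
  -- per-plaquette: |kl − Tn L| ≤ Tn g K + (12b + 8b') sh
  have hsum_b : 2 * b * ∑ p ∈ plaquettesTouching (Λ n), min 4 (C * Real.exp (-(κ * ⌊m n p / (4 : ℕ)⌋₊))) ≤
      2 * b * (C * Real.exp (-(κ * ((K + 1 : ℕ) : ℝ))) * Tn + 4 * sh) := mul_le_mul_of_nonneg_left hS (by linarith)
  have hsum_b' : b' * ∑ p ∈ plaquettesTouching (Λ n), min 4 (C * Real.exp (-(κ' * ⌊m n p / (4 : ℕ)⌋₊))) ≤
      b' * (C * Real.exp (-(κ' * ((K + 1 : ℕ) : ℝ))) * Tn + 4 * sh) := mul_le_mul_of_nonneg_left hS' hb0'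
  have hDb : 4 * (b + b') * ((((plaquettesTouching (Λ n)).filter fun p => ¬plaquetteEdges p ⊆ Λ n).card : ℕ) : ℝ) ≤ 4 * (b + b') * sh :=
    mul_le_mul_of_nonneg_left hD (by linarith)
  have habs : |kl - Tn * L| ≤ Tn * g K + (12 * b + 8 * b') * sh := by
    refine hmain.trans ?_
    have e : Tn * g K + (12 * b + 8 * b') * sh = 2 * b * (C * Real.exp (-(κ * ((K + 1 : ℕ) : ℝ))) * Tn + 4 * sh) +
        b' * (C * Real.exp (-(κ' * ((K + 1 : ℕ) : ℝ))) * Tn + 4 * sh) + 4 * (b + b') * sh := by rw [hg]; ring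
    rw [e]
    exact add_le_add (add_le_add hsum_b hsum_b') hDb
  -- divide by Tn
  have hdiv : |kl / Tn - L| ≤ g K + (12 * b + 8 * b') * (sh / Tn) := by
    rw [show kl / Tn - L = (kl - Tn * L) / Tn by field_simp, abs_div, abs_of_pos hTpos, div_le_iff₀ hTpos]
    have e : (g K + (12 * b + 8 * b') * (sh / Tn)) * Tn = Tn * g K + (12 * b + 8 * b') * sh := by field_simp
    rw [e]
    exact habs
  linarith [hdiv, hK']

end SU2

end BoundaryFreeEnergy

end Summit.Ventures.YMGap.RobustBall

end
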